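import Summits.Ventures.AbcSig.Levels.N7712P1
import Summits.Ventures.AbcSig.Levels.N7712P2
import Summits.Ventures.AbcSig.Levels.N7712Q1
import Summits.Ventures.AbcSig.Levels.N7712Q2
import Summits.Ventures.AbcSig.Levels.N7712Q3

/-!
# Venture AbcSig — GENERATED level file, level 7712 (AGGREGATOR of 5 part files)

HONEST FRAMING. As in the part files `N7712<part>.lean`, parts P1, P2, Q1, Q2, Q3 (a MIXED split: parts of
different size-splits of the same generator output landed in the tree at different times; every part carries the orbit
blocks of one contiguous run of orbits of the same certified level file `N7712.engine1.json`,
sha256 `ecf04ad42d9237249d6308bdae92bbd952eeb70bb99d63195493d9b657a1bff5`): this file only concatenates the orbit lists and the part summaries into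
`level7712Orbits`, `level7712_wellformed`, `level7712_sieve` (the shapes the row templates consume). The split exists because the
tree's files are ≤ 400 lines and ≤ 200 000 bytes. Union of residual exponents ≥ 7: [7, 17, 53]; orbits not eliminable by
the sieve: none. No Diophantine statement is made here; no claim on ABC or any summit.
-/

namespace Summit.Ventures.AbcSig

/-- All newform orbits of level 7712 (concatenation of the parts, engine order). -/
def level7712Orbits : List OrbitData :=
  level7712OrbitsP1 ++ level7712OrbitsP2 ++ level7712OrbitsQ1 ++ level7712OrbitsQ2 ++ level7712OrbitsQ3

/-- Every listed entry is at an odd prime not dividing 7712. -/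
theorem level7712_wellformed :
    ∀ o ∈ level7712Orbits, ∀ e ∈ o.coeffs, e.ell.Prime ∧ e.ell ≠ 2 ∧ ¬ e.ell ∣ 7712 := by
  unfold level7712Orbits
  exact List.forall_mem_append.2 ⟨List.forall_mem_append.2 ⟨List.forall_mem_append.2 ⟨List.forall_mem_append.2 ⟨level7712_wellformedP1, level7712_wellformedP2⟩, level7712_wellformedQ1⟩, level7712_wellformedQ2⟩, level7712_wellformedQ3⟩

/-- **Level 7712 summary.** For a prime exponent `n ≥ 7`, every orbit of level 7712 is sieve-eliminated by the
kernel certificates of the part files, except that the row's predicate `X` is assumed for: orbit_7712_2 if n ∈ [7, 17], orbit_7712_7 if n ∈ [7], orbit_7712_8 if n ∈ [7], orbit_7712_9 if n ∈ [53]. -/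
theorem level7712_sieve (n : ℕ) (hn : n.Prime) (hmin : 7 ≤ n) (X : OrbitData → Prop)
    (h_orbit_7712_2 : n ∈ ([7, 17] : List ℕ) → X orbit_7712_2)
    (h_orbit_7712_7 : n ∈ ([7] : List ℕ) → X orbit_7712_7)
    (h_orbit_7712_8 : n ∈ ([7] : List ℕ) → X orbit_7712_8)
    (h_orbit_7712_9 : n ∈ ([53] : List ℕ) → X orbit_7712_9) :
    ∀ o ∈ level7712Orbits, (∀ e ∈ o.coeffs, e.ell.Prime ∧ e.ell ≠ 2 ∧ ¬ e.ell ∣ 7712) ∧ (o.Eliminated bs04Allowed n ∨ X o) := by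
  unfold level7712Orbits
  exact List.forall_mem_append.2 ⟨List.forall_mem_append.2 ⟨List.forall_mem_append.2 ⟨List.forall_mem_append.2 ⟨(level7712_sieveP1 n hn hmin X h_orbit_7712_2), (level7712_sieveP2 n hn hmin X)⟩, (level7712_sieveQ1 n hn hmin X h_orbit_7712_7)⟩, (level7712_sieveQ2 n hn hmin X h_orbit_7712_8)⟩, (level7712_sieveQ3 n hn hmin X h_orbit_7712_9)⟩

end Summit.Ventures.AbcSig
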